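import Summits.PneNP.PneNP.Theorems.ChebyshevTracialDesignJuntaMatchingCount
import HarnessLib

/-!
# Junta virtual positivity, part E₁: matching-side fibres over a prescribed sub-matching

Support file for the crux `TracialDecayExp20` (stmt-PneNP-19878) of route `ChebyshevTracialDesign`
(cell pnp-psdrank, local virtual positivity (N1), MATCHING-SIDE twin; builds on parts A, D).
For a cut `U ⊆ S` (`|U| = t = a + 2i`, `|S \ U| = s = a + 2i'`) and a sub-matching `E` on `W ⊆ S` with
`y` edges crossing `U`, `z` inside `U`, `e` outside: `card_pm_filter_superset` (the matchings `M ⊇ E`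
with `a` crossing edges ↔ matchings of `S \ W`) and the ratio identity `card_pm_fiber_ratio_nat`:
`#{M ⊇ E : #cr = a} · [t]_{y+2z}[s]_{y+2e} = #{M : #cr = a} · [a]_y · 2^z[i]_z · 2^e[i']_e`.
No definitions; notation as in parts A/D.
-/

set_option linter.dupNamespace false -- `Summit.PneNP.PneNP.…`: summit = sub-problem (D-0017)

namespace Summit.PneNP.PneNP.Theorems.ChebyshevTracialDesignJunta

open Finset Literature.Barriers.PneNP Literature.Combinatorics.SimpleGraph.CycleSpace

variable {V : Type*} [DecidableEq V]

/-! ### Part E: fibres over a prescribed sub-matching and the matching-side pattern law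

For a cut `U ⊆ S` (`|U| = t = a + 2i`, `|S \ U| = s = a + 2i'`) and a sub-matching `E` on `W ⊆ S` with `y`
crossing, `z` inside `U`, `e` inside `S \ U` (`x = y + z + e` edges), the perfect matchings `M ⊇ E` of `S`
with `a` crossing edges number `fiber`, and
`fiber · [t]_{y+2z} · [s]_{y+2e} = total · [a]_y · 2^z [i]_z · 2^e [i']_e`
(`card_pm_fiber_ratio_nat`), i.e. `P_{M | U, cc = a}[E ⊆ M]` is the value at `a` of the polynomial
`[X]_y · ∏_{j<z}(t - X - 2j) · ∏_{j<e}(s - X - 2j) / ([t]_{y+2z}[s]_{y+2e})` of degree `x` with nonnegative value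
at the virtual level `X = 0` (`pattern_poly_exists_pm`). -/

section MatchingFiber

/-- `|U ∩ W| = #cr(U,E) + 2·#in(U,E)` for a perfect matching `E` of `W`. [folklore] -/
theorem card_inter_verts_eq {U W : Finset V} {E : Finset (Sym2 V)} (hE : IsPMOn W E) :
    (U ∩ W).card = (E.filter fun e => cutCount U e = 1).card + 2 * (E.filter fun e => cutCount U e = 2).card := by
  rw [card_eq_cr_add_two_mul_in hE inter_subset_right, card_filter_cutCount_inter hE.1,
    card_filter_cutCount_inter hE.1]

/-- `|W \ U| + |U ∩ W| = 2|E|` in the form `|W \ U| + #cr + 2·#in = 2|E|`. [folklore] -/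
theorem card_verts_sdiff_eq {U W : Finset V} {E : Finset (Sym2 V)} (hE : IsPMOn W E) :
    (W \ U).card + (E.filter fun e => cutCount U e = 1).card + 2 * (E.filter fun e => cutCount U e = 2).card =
      2 * E.card := by
  have h1 := card_inter_verts_eq (U := U) hE
  -- 2|E| = |W|: every edge of `E` is internal to `W`
  have h0 : (E.filter fun e => cutCount W e = 1).card = 0 := by
    rw [card_eq_zero, filter_eq_empty_iff]
    intro e he h1'
    induction e using Sym2.ind with
    | h a b =>
      have hab := mem_sym2_iff.1 (hE.1 he)
      rw [cutCount_mk, if_pos (hab a (Sym2.mem_mk_left a b)), if_pos (hab b (Sym2.mem_mk_right a b))] at h1'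
      exact absurd h1' (by decide)
  have hin : (E.filter fun e => cutCount W e = 2) = E := by
    refine filter_true_of_mem fun e he => ?_
    induction e using Sym2.ind with
    | h a b =>
      have hab := mem_sym2_iff.1 (hE.1 he)
      rw [cutCount_mk, if_pos (hab a (Sym2.mem_mk_left a b)), if_pos (hab b (Sym2.mem_mk_right a b))]
  have h2 : W.card = 2 * E.card := by
    rw [card_eq_cr_add_two_mul_in hE Subset.rfl, h0, hin, zero_add]
  have h3 : (W \ U).card + (U ∩ W).card = W.card := by
    rw [inter_comm, card_sdiff_add_card_inter]
  omega

/-- **Fibre over a prescribed sub-matching**: perfect matchings `M ⊇ E` of `S` with `a` crossing edges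
correspond (`M ↦ M \ E`) to perfect matchings of `S \ W` whose crossing count plus `#cr(U,E)` is `a`.
[folklore] -/
theorem card_pm_filter_superset {S W U : Finset V} {E : Finset (Sym2 V)} (hW : W ⊆ S) (hE : IsPMOn W E)
    (a : ℕ) :
    ((perfectMatchings S).filter fun M => E ⊆ M ∧ (M.filter fun e => cutCount U e = 1).card = a).card =
      ((perfectMatchings (S \ W)).filter fun M' =>
        (E.filter fun e => cutCount U e = 1).card +
          (M'.filter fun e => cutCount (U ∩ (S \ W)) e = 1).card = a).card := by
  have hS : S = W ∪ (S \ W) := (union_sdiff_of_subset hW).symm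
  have hd : Disjoint W (S \ W) := disjoint_sdiff
  have hsplit : ∀ M' : Finset (Sym2 V), IsPMOn (S \ W) M' →
      ((E ∪ M').filter fun e => cutCount U e = 1).card =
        (E.filter fun e => cutCount U e = 1).card + (M'.filter fun e => cutCount (U ∩ (S \ W)) e = 1).card := by
    intro M' hM'
    rw [card_filter_cutCount_union (disjoint_of_subset_sym2 hd hE.1 hM'.1), card_filter_cutCount_inter hM'.1]
  refine card_nbij' (fun M => M \ E) (fun M' => E ∪ M') ?_ ?_ ?_ ?_
  · intro M hM
    simp only [mem_coe, mem_filter, mem_perfectMatchings] at hM ⊢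
    obtain ⟨hM, hEM, ha⟩ := hM
    have h' : IsPMOn (W ∪ (S \ W)) M := by rwa [← hS]
    have hM' : IsPMOn (S \ W) (M \ E) := h'.sdiff hd hE hEM
    refine ⟨hM', ?_⟩
    rw [← hsplit _ hM', union_sdiff_of_subset hEM, ha]
  · intro M' hM'
    simp only [mem_coe, mem_filter, mem_perfectMatchings] at hM' ⊢
    obtain ⟨hM', ha⟩ := hM'
    have hM : IsPMOn S (E ∪ M') := by rw [hS]; exact hE.union hM' hd
    exact ⟨hM, subset_union_left, by rw [hsplit _ hM', ha]⟩
  · intro M hM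
    simp only [mem_coe, mem_filter] at hM
    exact union_sdiff_of_subset hM.2.1
  · intro M' hM'
    simp only [mem_coe, mem_filter, mem_perfectMatchings] at hM'
    have hdis : Disjoint E M' := disjoint_of_subset_sym2 hd hE.1 hM'.1.1
    show (E ∪ M') \ E = M'
    rw [union_sdiff_left, Finset.sdiff_eq_self_iff_disjoint]
    exact hdis.symm

/-- **The matching-side ratio identity in `ℕ`**: with `fiber`, `total` as in the section docstring,
`fiber · [t]_{y+2z} · [s]_{y+2e} = total · [a]_y · (2^z [i]_z) · (2^e [i']_e)`. [folklore] -/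
theorem card_pm_fiber_ratio_nat {S W U : Finset V} {E : Finset (Sym2 V)} (hU : U ⊆ S) (hW : W ⊆ S)
    (hE : IsPMOn W E) {a i i' : ℕ} (hUc : U.card = a + 2 * i) (hSc : (S \ U).card = a + 2 * i') :
    ((perfectMatchings S).filter fun M => E ⊆ M ∧ (M.filter fun e => cutCount U e = 1).card = a).card *
        ((a + 2 * i).descFactorial
            ((E.filter fun e => cutCount U e = 1).card + 2 * (E.filter fun e => cutCount U e = 2).card) *
          (a + 2 * i').descFactorial
            ((E.filter fun e => cutCount U e = 1).card +
              2 * (E.card - (E.filter fun e => cutCount U e = 1).card - (E.filter fun e => cutCount U e = 2).card))) =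
      ((perfectMatchings S).filter fun M => (M.filter fun e => cutCount U e = 1).card = a).card *
        (a.descFactorial (E.filter fun e => cutCount U e = 1).card *
          (2 ^ (E.filter fun e => cutCount U e = 2).card * i.descFactorial (E.filter fun e => cutCount U e = 2).card) *
          (2 ^ (E.card - (E.filter fun e => cutCount U e = 1).card - (E.filter fun e => cutCount U e = 2).card) *
            i'.descFactorial
              (E.card - (E.filter fun e => cutCount U e = 1).card - (E.filter fun e => cutCount U e = 2).card))) := by
  -- abbreviations
  set y := (E.filter fun e => cutCount U e = 1).card with hy
  set z := (E.filter fun e => cutCount U e = 2).card with hz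
  set ee := E.card - y - z with hee
  have hyz : y + z ≤ E.card := by
    rw [hy, hz, ← card_union_of_disjoint (disjoint_filter.2 fun e _ h1 h2 => by omega)]
    exact card_le_card (union_subset (filter_subset _ _) (filter_subset _ _))
  have hUW : (U ∩ W).card = y + 2 * z := card_inter_verts_eq hE
  have hWU : (W \ U).card = y + 2 * ee := by have := card_verts_sdiff_eq (U := U) hE; omega
  have hle1 : y + 2 * z ≤ U.card := by rw [← hUW]; exact card_le_card inter_subset_left
  have hle2 : y + 2 * ee ≤ (S \ U).card := by rw [← hWU]; exact card_le_card (sdiff_subset_sdiff hW Subset.rfl)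
  -- sizes of the sub-configuration
  have hU' : (U ∩ (S \ W)).card = U.card - (y + 2 * z) := by
    have : U ∩ (S \ W) = U \ (U ∩ W) := by
      ext w; simp only [mem_inter, mem_sdiff]
      constructor
      · rintro ⟨hwU, -, hwW⟩; exact ⟨hwU, fun h => hwW h.2⟩
      · rintro ⟨hwU, h⟩; exact ⟨hwU, hU hwU, fun hwW => h ⟨hwU, hwW⟩⟩
    rw [this, card_sdiff_of_subset inter_subset_left, hUW]
  have hS' : ((S \ W) \ (U ∩ (S \ W))).card = (S \ U).card - (y + 2 * ee) := by
    have h1 : (S \ W) \ (U ∩ (S \ W)) = (S \ U) \ (W \ U) := by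
      ext w; simp only [mem_sdiff, mem_inter]
      constructor
      · rintro ⟨⟨hwS, hwW⟩, h⟩
        exact ⟨⟨hwS, fun hwU => h ⟨hwU, hwS, hwW⟩⟩, fun h' => hwW h'.1⟩
      · rintro ⟨⟨hwS, hwU⟩, h⟩
        exact ⟨⟨hwS, fun hwW => h ⟨hwW, hwU⟩⟩, fun h' => hwU h'.1⟩
    have h2 : W \ U ⊆ S \ U := sdiff_subset_sdiff hW Subset.rfl
    rw [h1, card_sdiff_of_subset h2, hWU]
  have htot := card_pm_filter_cr_mul hU hUc hSc
  rw [card_pm_filter_superset hW hE a]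
  by_cases hya : y ≤ a
  · by_cases hzi : z ≤ i
    · by_cases hei : ee ≤ i'
      · -- non-degenerate: the sub-configuration has parameters (a - y, i - z, i' - ee)
        have hfilt : ((perfectMatchings (S \ W)).filter fun M' =>
              y + (M'.filter fun e => cutCount (U ∩ (S \ W)) e = 1).card = a) =
            (perfectMatchings (S \ W)).filter fun M' =>
              (M'.filter fun e => cutCount (U ∩ (S \ W)) e = 1).card = a - y :=
          filter_congr fun M' _ => by omega
        rw [hfilt]
        have hU'c : (U ∩ (S \ W)).card = (a - y) + 2 * (i - z) := by rw [hU', hUc]; omega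
        have hS'c : ((S \ W) \ (U ∩ (S \ W))).card = (a - y) + 2 * (i' - ee) := by rw [hS', hSc]; omega
        have hfib := card_pm_filter_cr_mul (inter_subset_right (s₁ := U) (s₂ := S \ W)) hU'c hS'c
        -- K(a,i,i') = K(a-y,i-z,i'-ee) · ([a]_y · 2^z [i]_z · 2^ee [i']_ee)
        have hKa := Nat.factorial_mul_descFactorial hya
        have hKi := Nat.factorial_mul_descFactorial hzi
        have hKi' := Nat.factorial_mul_descFactorial hei
        have hpi : 2 ^ i = 2 ^ (i - z) * 2 ^ z := by rw [← pow_add, Nat.sub_add_cancel hzi]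
        have hpi' : 2 ^ i' = 2 ^ (i' - ee) * 2 ^ ee := by rw [← pow_add, Nat.sub_add_cancel hei]
        -- t! = (t - (y+2z))! [t]_{y+2z}
        have ht1 : y + 2 * z ≤ a + 2 * i := by omega
        have ht2 : y + 2 * ee ≤ a + 2 * i' := by omega
        have hT := Nat.factorial_mul_descFactorial ht1
        have hT' := Nat.factorial_mul_descFactorial ht2
        have e1 : a + 2 * i - (y + 2 * z) = (a - y) + 2 * (i - z) := by omega
        have e2 : a + 2 * i' - (y + 2 * ee) = (a - y) + 2 * (i' - ee) := by omega
        rw [e1] at hT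
        rw [e2] at hT'
        -- cancel the positive factor K' = (a-y)! 2^{i-z} (i-z)! 2^{i'-ee} (i'-ee)!
        have hK'pos : 0 < (a - y).factorial * (2 ^ (i - z) * (i - z).factorial) * (2 ^ (i' - ee) * (i' - ee).factorial) := by
          positivity
        refine Nat.eq_of_mul_eq_mul_right hK'pos ?_
        calc ((perfectMatchings (S \ W)).filter fun M' =>
                (M'.filter fun e => cutCount (U ∩ (S \ W)) e = 1).card = a - y).card *
              ((a + 2 * i).descFactorial (y + 2 * z) * (a + 2 * i').descFactorial (y + 2 * ee)) *
              ((a - y).factorial * (2 ^ (i - z) * (i - z).factorial) * (2 ^ (i' - ee) * (i' - ee).factorial))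
            = (((perfectMatchings (S \ W)).filter fun M' =>
                (M'.filter fun e => cutCount (U ∩ (S \ W)) e = 1).card = a - y).card *
                ((a - y).factorial * (2 ^ (i - z) * (i - z).factorial) * (2 ^ (i' - ee) * (i' - ee).factorial))) *
              ((a + 2 * i).descFactorial (y + 2 * z) * (a + 2 * i').descFactorial (y + 2 * ee)) := by ring
          _ = ((a - y + 2 * (i - z)).factorial * (a + 2 * i).descFactorial (y + 2 * z)) *
              ((a - y + 2 * (i' - ee)).factorial * (a + 2 * i').descFactorial (y + 2 * ee)) := by rw [hfib]; ring
          _ = (a + 2 * i).factorial * (a + 2 * i').factorial := by rw [hT, hT']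
          _ = ((perfectMatchings S).filter fun M => (M.filter fun e => cutCount U e = 1).card = a).card *
              (a.factorial * (2 ^ i * i.factorial) * (2 ^ i' * i'.factorial)) := htot.symm
          _ = ((perfectMatchings S).filter fun M => (M.filter fun e => cutCount U e = 1).card = a).card *
              (((a - y).factorial * a.descFactorial y) * (2 ^ (i - z) * 2 ^ z * ((i - z).factorial * i.descFactorial z)) *
                (2 ^ (i' - ee) * 2 ^ ee * ((i' - ee).factorial * i'.descFactorial ee))) := by
              rw [hKa, hKi, hKi', ← hpi, ← hpi']
          _ = ((perfectMatchings S).filter fun M => (M.filter fun e => cutCount U e = 1).card = a).card *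
              (a.descFactorial y * (2 ^ z * i.descFactorial z) * (2 ^ ee * i'.descFactorial ee)) *
              ((a - y).factorial * (2 ^ (i - z) * (i - z).factorial) * (2 ^ (i' - ee) * (i' - ee).factorial)) := by
              ring
      · -- `ee > i'`: the complement side of the sub-configuration is too small; `[i']_ee = 0`
        have hlt : i' < ee := not_le.1 hei
        rw [Nat.descFactorial_eq_zero_iff_lt.2 hlt]
        simp only [mul_zero]
        rw [Nat.mul_eq_zero]; left
        rw [card_eq_zero]
        have hfilt : ((perfectMatchings (S \ W)).filter fun M' =>
              y + (M'.filter fun e => cutCount (U ∩ (S \ W)) e = 1).card = a) =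
            (perfectMatchings (S \ W)).filter fun M' =>
              (M'.filter fun e => cutCount (U ∩ (S \ W)) e = 1).card = a - y :=
          filter_congr fun M' _ => by omega
        rw [hfilt]
        exact pm_filter_cr_eq_empty inter_subset_right (fun h => by
          have h2 := h.2.1; rw [hS', hSc] at h2; omega)
    · -- `z > i`
      have hlt : i < z := not_le.1 hzi
      rw [Nat.descFactorial_eq_zero_iff_lt.2 hlt]
      simp only [mul_zero, zero_mul]
      rw [Nat.mul_eq_zero]; left
      rw [card_eq_zero]
      have hfilt : ((perfectMatchings (S \ W)).filter fun M' =>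
            y + (M'.filter fun e => cutCount (U ∩ (S \ W)) e = 1).card = a) =
          (perfectMatchings (S \ W)).filter fun M' =>
            (M'.filter fun e => cutCount (U ∩ (S \ W)) e = 1).card = a - y :=
        filter_congr fun M' _ => by omega
      rw [hfilt]
      exact pm_filter_cr_eq_empty inter_subset_right (fun h => by
        have h1 := h.1; rw [hU', hUc] at h1; omega)
  · -- `y > a`
    have hlt : a < y := not_le.1 hya
    rw [Nat.descFactorial_eq_zero_iff_lt.2 hlt]
    simp only [zero_mul, mul_zero]
    rw [Nat.mul_eq_zero]; left
    rw [card_eq_zero, filter_eq_empty_iff]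
    intro M' _ h
    omega

end MatchingFiber


end Summit.PneNP.PneNP.Theorems.ChebyshevTracialDesignJunta
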